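import Literature.Probability.Process.ItoCalculus
import HarnessLib

/-!
# Negation in the Itô characterisation: `∫ (-H) dB = ∫ H d(-B) = -∫ H dB`

Sign bookkeeping for the interface `Literature.Probability.Process.IsItoIntegral` of
`Literature.Probability.Process.ItoCalculus` (the Itô integral characterised as the u.c.p. limit
of elementary integrals along every approximating sequence of bounded simple processes), generic
in the filtered probability space `(Ω, 𝓕, P)` and in the integrator `B`:

* `SimpleProcess.neg` — the simple process `-H` (same partition, negated values), with
  `toProcess_neg`, `integral_neg` (`(-H)·B = -(H·B)`) and `integral_neg_right`
  (`H·(-B) = -(H·B)`);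
* `SimpleProcess.IsApproxSeq.neg`, `TendstoUCP.neg`, `IsLocalMartingale.neg`;
* `IsItoIntegral.neg` — `IsItoIntegral H B J → IsItoIntegral (-H) B (-J)`;
* `IsItoIntegral.neg_right` — `IsItoIntegral H B J → IsItoIntegral H (-B) (-J)`.

These are the linearity statements `(-K)·M = K·(-M) = -(K·M)` of Revuz–Yor, Ch. IV, (2.4) and
Prop. (2.5)/(2.10)(i) (bilinearity of the stochastic integral), read in the characterised form;
they are used by the SLE–Bessel bridge (`Literature.Analysis.FunctionSpaces.SLEBessel`), where the
driver is `-B` and where `Z ↦ -Z` exchanges the squared Bessel equations driven by `B` and `-B`.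

## References

* D. Revuz, M. Yor, *Continuous Martingales and Brownian Motion* (3rd ed., 1999), Ch. IV,
  Def. (2.3), eq. (2.4), Prop. (2.5), Prop. (2.10)(i), Prop. (2.13); Ch. IV, Def. (1.5).
-/

open MeasureTheory ProbabilityTheory Filter Finset
open scoped NNReal ENNReal Topology

noncomputable section

namespace Literature.Probability.Process

variable {Ω : Type*} {m : MeasurableSpace Ω}

namespace SimpleProcess

variable {𝓕 : Filtration ℝ≥0 m}

/-- The **negated simple process** `-H`: same partition times, values `-Hᵢ`.
Revuz–Yor, *Continuous Martingales and Brownian Motion* (1999), Ch. IV, Def. (2.3) (`ℰ` is a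
vector space). [folklore] -/
def neg (H : SimpleProcess m 𝓕) : SimpleProcess m 𝓕 where
  times := H.times
  sorted := H.sorted
  value i ω := -H.value i ω
  measurable i h := (H.measurable i h).neg
  bounded := H.bounded.imp fun C hC i ω ↦ by rw [abs_neg]; exact hC i ω

/-- The partition times of `-H` are those of `H`. [folklore] -/
@[simp]
theorem neg_time (H : SimpleProcess m 𝓕) (i : ℕ) : H.neg.time i = H.time i := rfl

/-- The values of `-H` are the negated values of `H`. [folklore] -/
@[simp]
theorem neg_value (H : SimpleProcess m 𝓕) (i : ℕ) (ω : Ω) : H.neg.value i ω = -H.value i ω := rfl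

/-- The step process of `-H` is minus the step process of `H`.
Revuz–Yor, *Continuous Martingales and Brownian Motion* (1999), Ch. IV, Def. (2.3). [folklore] -/
theorem toProcess_neg (H : SimpleProcess m 𝓕) (t : ℝ≥0) (ω : Ω) :
    H.neg.toProcess t ω = -H.toProcess t ω := by
  unfold toProcess
  rw [← Finset.sum_neg_distrib]
  refine Finset.sum_congr (by rfl) fun i _ ↦ ?_
  rw [neg_time, neg_time]
  exact congrFun (Set.indicator_neg (Set.Ioc (H.time i) (H.time (i + 1)))
    (fun _ : ℝ≥0 ↦ H.value i ω)) t

/-- **`(-H)·B = -(H·B)`** for the elementary integral (pathwise).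
Revuz–Yor, *Continuous Martingales and Brownian Motion* (1999), Ch. IV, eq. (2.4). [folklore] -/
theorem integral_neg (H : SimpleProcess m 𝓕) (B : ℝ≥0 → Ω → ℝ) (t : ℝ≥0) (ω : Ω) :
    H.neg.integral B t ω = -H.integral B t ω := by
  unfold integral
  rw [← Finset.sum_neg_distrib]
  refine Finset.sum_congr (by rfl) fun i _ ↦ ?_
  rw [neg_time, neg_time, neg_value, neg_mul]

/-- **`H·(-B) = -(H·B)`** for the elementary integral (pathwise).
Revuz–Yor, *Continuous Martingales and Brownian Motion* (1999), Ch. IV, eq. (2.4). [folklore] -/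
theorem integral_neg_right (H : SimpleProcess m 𝓕) (B : ℝ≥0 → Ω → ℝ) (t : ℝ≥0) (ω : Ω) :
    H.integral (fun s ω ↦ -B s ω) t ω = -H.integral B t ω := by
  unfold integral
  rw [← Finset.sum_neg_distrib]
  refine Finset.sum_congr rfl fun i _ ↦ ?_
  ring

/-- Approximating sequences pass to negatives: if `Hₙ → H` in `L²_loc(ds)` in probability then
`-Hₙ → -H` (the integrands `(Hₙ - H)²` are unchanged).
Revuz–Yor, *Continuous Martingales and Brownian Motion* (1999), Ch. IV, Def. (2.9). [folklore] -/
theorem IsApproxSeq.neg {Hn : ℕ → SimpleProcess m 𝓕} {H : ℝ≥0 → Ω → ℝ} {P : Measure Ω}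
    (h : IsApproxSeq Hn H P) : IsApproxSeq (fun n ↦ (Hn n).neg) (fun t ω ↦ -H t ω) P := by
  intro t ε hε
  have key : ∀ (n : ℕ) (ω : Ω) (s : ℝ),
      ((Hn n).neg.toProcess s.toNNReal ω - -H s.toNNReal ω) ^ 2 =
        ((Hn n).toProcess s.toNNReal ω - H s.toNNReal ω) ^ 2 := by
    intro n ω s
    rw [toProcess_neg]
    ring
  simp only [key]
  exact h t ε hε

end SimpleProcess

/-- u.c.p. convergence passes to negatives.
Revuz–Yor, *Continuous Martingales and Brownian Motion* (1999), Ch. IV, Prop. (2.13). [folklore] -/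
theorem TendstoUCP.neg {Y : ℕ → ℝ≥0 → Ω → ℝ} {J : ℝ≥0 → Ω → ℝ} {P : Measure Ω}
    (h : TendstoUCP Y J P) :
    TendstoUCP (fun n t ω ↦ -Y n t ω) (fun t ω ↦ -J t ω) P := by
  intro t ε hε
  have key : ∀ (n : ℕ) (s : ℝ≥0) (ω : Ω), |-Y n s ω - -J s ω| = |Y n s ω - J s ω| := by
    intro n s ω
    rw [neg_sub_neg, abs_sub_comm]
  simp only [key]
  exact h t ε hε

/-- **The negative of a local martingale is a local martingale** (same localizing sequence; the
stopped indicator processes of `-X` are the negatives of those of `X`, and Mathlib's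
`Martingale.neg`).
Revuz–Yor, *Continuous Martingales and Brownian Motion* (1999), Ch. IV, Def. (1.5) (local
martingales form a vector space). [folklore] -/
theorem _root_.Literature.Probability.RandomPlanarGeometry.IsLocalMartingale.neg {X : ℝ≥0 → Ω → ℝ} {𝓕 : Filtration ℝ≥0 m} {P : Measure Ω}
    (h : RandomPlanarGeometry.IsLocalMartingale X 𝓕 P) : RandomPlanarGeometry.IsLocalMartingale (fun t ω ↦ -X t ω) 𝓕 P := by
  obtain ⟨τ, hτ, hmart⟩ := h
  refine ⟨τ, hτ, fun n ↦ ?_⟩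
  have heq : stoppedProcess (fun i ↦ {ω | ⊥ < τ n ω}.indicator ((fun t ω ↦ -X t ω) i)) (τ n) =
      -stoppedProcess (fun i ↦ {ω | ⊥ < τ n ω}.indicator (X i)) (τ n) := by
    have h1 : (fun i ↦ {ω | ⊥ < τ n ω}.indicator ((fun t ω ↦ -X t ω) i)) =
        -(fun i ↦ {ω | ⊥ < τ n ω}.indicator (X i)) := by
      funext i
      exact Set.indicator_neg {ω | ⊥ < τ n ω} (X i)
    rw [h1, stoppedProcess_neg]
  rw [heq]
  exact (hmart n).neg

section Ito

variable {H B J : ℝ≥0 → Ω → ℝ} {𝓕 : Filtration ℝ≥0 m} {P : Measure Ω}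

/-- **`∫ (-H) dB = -∫ H dB` in the Itô characterisation**: if `J` is the Itô integral of `H`
against `B`, then `-J` is the Itô integral of `-H` against `B`. (Approximating sequences of `-H`
are exactly the negatives of those of `H`, and `(-Hₙ)·B = -(Hₙ·B)`.)
Revuz–Yor, *Continuous Martingales and Brownian Motion* (1999), Ch. IV, Thm (2.2) and
Prop. (2.10)(i) (linearity of `K ↦ K·M`), Prop. (2.13). [folklore] -/
theorem IsItoIntegral.neg (h : IsItoIntegral H B J 𝓕 P) :
    IsItoIntegral (fun t ω ↦ -H t ω) B (fun t ω ↦ -J t ω) 𝓕 P := by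
  obtain ⟨h0, hc, hm, ⟨Hn, hHn⟩, hall⟩ := h
  refine ⟨fun ω ↦ by simp only [h0 ω, neg_zero], ?_, hm.neg, ⟨fun n ↦ (Hn n).neg, hHn.neg⟩,
    fun Gn hGn ↦ ?_⟩
  · filter_upwards [hc] with ω hω
    exact hω.neg
  · have h1 : SimpleProcess.IsApproxSeq (fun n ↦ (Gn n).neg) H P := by
      have := hGn.neg
      simpa only [neg_neg] using this
    have h2 := hall _ h1
    have h3 : (fun n ↦ (Gn n).integral B) = fun n t ω ↦ -((Gn n).neg.integral B t ω) := by
      funext n t ω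
      rw [SimpleProcess.integral_neg, neg_neg]
    rw [h3]
    exact h2.neg

/-- **`∫ H d(-B) = -∫ H dB` in the Itô characterisation**: if `J` is the Itô integral of `H`
against `B`, then `-J` is the Itô integral of `H` against `-B` (same approximating sequences;
`Hₙ·(-B) = -(Hₙ·B)`). With `B` a Brownian motion, `-B` is again one, for the same filtration.
Revuz–Yor, *Continuous Martingales and Brownian Motion* (1999), Ch. IV, Thm (2.2), eq. (2.4)
and Prop. (2.13). [folklore] -/
theorem IsItoIntegral.neg_right (h : IsItoIntegral H B J 𝓕 P) :
    IsItoIntegral H (fun t ω ↦ -B t ω) (fun t ω ↦ -J t ω) 𝓕 P := by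
  obtain ⟨h0, hc, hm, hex, hall⟩ := h
  refine ⟨fun ω ↦ by simp only [h0 ω, neg_zero], ?_, hm.neg, hex, fun Gn hGn ↦ ?_⟩
  · filter_upwards [hc] with ω hω
    exact hω.neg
  · have h2 := hall Gn hGn
    have h3 : (fun n ↦ (Gn n).integral fun s ω ↦ -B s ω) =
        fun n t ω ↦ -((Gn n).integral B t ω) := by
      funext n t ω
      rw [SimpleProcess.integral_neg_right]
    rw [h3]
    exact h2.neg

/-- `∫ (-H) d(-B) = ∫ H dB`: negating both the integrand and the integrator does not change the
Itô integral (two applications of the sign rules).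
Revuz–Yor, *Continuous Martingales and Brownian Motion* (1999), Ch. IV, Prop. (2.10)(i). [folklore] -/
theorem IsItoIntegral.neg_neg_right (h : IsItoIntegral H B J 𝓕 P) :
    IsItoIntegral (fun t ω ↦ -H t ω) (fun t ω ↦ -B t ω) J 𝓕 P := by
  have := h.neg.neg_right
  simpa only [_root_.neg_neg] using this

end Ito

end Literature.Probability.Process
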